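import Summits.ResolutionOfSingularities.ResolutionOfSingularities.Theses.FrobeniusClosing

/-!
# `ClosingReduction` — negative lemmas I: the load-bearing predicates of the arena, and the empty
# dimension-one regime

Support (negative) lemmas for crux `stmt-ResolutionOfSingularities-16347`
(`Summit.ResolutionOfSingularities.ResolutionOfSingularities.Theses.FrobeniusClosing.ClosingReduction :=
NoPeriodicIsolatedAtom → BoundedMilnor → IsolatedForcedTermination`, route `FrobeniusClosing`), filed by
the standing disprover (cdisprove cycle 1; work file `Cruxes/ClosingReduction/Disproof.lean`, which carries
the full analysis: `¬ ClosingReduction ↔ N ∧ B ∧ ¬T`, so the crux is refutable only by PROVING the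
certificate N and the bound B and exhibiting an eternal isolated multiplicity-`p` run — no computation
and no junk model can do it). This file declares NO definition: every variant statement is the route's
`let`-telescope written out verbatim with one predicate deleted (or `n` specialised), and NO declaration
concludes a route decl positively.

* `isolatedForcedTermination_false_without_Isol` — the crux's CONCLUSION with the forcedness predicate
  `Isol` deleted ("no eternal multiplicity-`p` run of the point-blow-up dynamics") is FALSE: over `𝔽₂`,
  `n = 2`, the atom `z² = u₀u₁²` reproduces itself EXACTLY under "blow up the point, chart `u₀`, pass to
  the origin of the exceptional divisor" (`u₀u₁² ↦ u₀³u₁² ↦ u₀u₁²`), so the run with chart word `0,0,…`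
  and zero translations is constant and every state has multiplicity `2`. This is the classical UNFORCED
  configuration (the singular locus of `z² = u₀u₁²` is the `u₀`-axis; one should blow up the curve) —
  Hauser–Perlega's cycles in miniature — and it is exactly what the route's restriction to ISOLATED
  points excludes: `curveBlowUp_witness_not_isolated` proves the witness is NOT isolated (the powers
  `u₀ᵏ` are linearly independent modulo the Jacobian ideal `⊆ (u₁²)`), so the lemma refutes the
  weakening and not the target.
* `noPeriodicIsolatedAtom_false_without_Isol` — the CERTIFICATE (hypothesis N of the crux) with `Isol`
  deleted is FALSE by the same atom: it is 1-periodic on the nose over the prime field (`r = 1`,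
  `φ = id`, `v = 1`, `g = 0`). So the non-isolated arena has periodic atoms for free and the content of
  rank 2 lies entirely in `Isol`; and a crux stated over the non-isolated arena would be VACUOUS.
* Companion file `Negative/DimensionOne.lean`: `MultP` is load-bearing (smooth germ `a = u₀`), and
  DIMENSION ONE IS EMPTY (the conclusion holds for `n = 1`: the cleaned order drops by `p` per step), so
  an honest counterexample needs `n ≥ 2` (`n = 2` excluded on paper by Zariski–Lipman).

Helper identity of independent use to provers of every item of this route (all share the dynamics):
`taylorShift_zero` (translation by `0` is the identity — the truncated Taylor sum collapses to `D = 0`).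

## Sources
* H. Hauser, S. Perlega, *Cycles of singularities appearing in the resolution problem in positive
  characteristic*, J. Algebraic Geom. 28 (2019) = arXiv:1802.05010, §1 (unforced cycles; no forced ones known).
-/

noncomputable section

set_option linter.dupNamespace false -- mandated namespace of this single-conjunct summit

open Summit.ResolutionOfSingularities.ResolutionOfSingularities.Theses.FrobeniusClosing

namespace Summit.ResolutionOfSingularities.ResolutionOfSingularities.Theorems.ClosingReduction.Negative

/-! ## Translation by zero -/

/-- **Translation by `0` is the identity**: in the route's truncated Taylor shift `tr i τ s c` with
`τ = 0` only the term `D = 0` survives (`0 ^ (D j) = 0` for `D j ≠ 0`, `j ≠ i`). [folklore] -/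
theorem taylorShift_zero (n : ℕ) (κ : Type) [Field κ] (i : Fin n) (s : ℕ) (c : (Fin n → ℕ) → κ)
    (B : Fin n → ℕ) :
    Finset.sum (Fintype.piFinset (fun _ : Fin n => Finset.range (B i + s + 1)))
      (fun D => @ite κ (D i = 0) (Classical.dec _) (c (B + D) * Finset.prod (Finset.univ.erase i)
        (fun j => ((Nat.choose (B j + D j) (B j) : ℕ) : κ) * (0 : κ) ^ (D j))) 0) = c B := by
  rw [Finset.sum_eq_single (0 : Fin n → ℕ)]
  · simp
  · intro D _ hD0
    by_cases hDi : D i = 0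
    · rw [if_pos hDi]
      obtain ⟨j, hj⟩ : ∃ j, D j ≠ 0 := by
        by_contra h
        push Not at h
        exact hD0 (funext h)
      have hji : j ≠ i := fun h => hj (h ▸ hDi)
      apply mul_eq_zero_of_right
      apply Finset.prod_eq_zero (Finset.mem_erase.2 ⟨hji, Finset.mem_univ j⟩)
      simp [hj]
    · rw [if_neg hDi]
  · intro h0
    exfalso
    apply h0
    simp [Fintype.mem_piFinset]

/-! ## The self-reproducing non-isolated atom `z² = u₀u₁²` over `𝔽₂` -/

/-- The run of `a = u₀u₁²` (`p = 2`, `n = 2`, `κ = 𝔽₂`) along the chart word `0,0,…` with zero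
translations is CONSTANT: `clean a = a`, `ord a = 3 ≥ 2`, strict transform in chart `u₀` is
`u₀u₁² ↦ u₀^3u₁²/u₀² = u₀u₁²`, translation by `0` is the identity. (The route's dynamics `let`s at
`p = n = 2`, `κ = ZMod 2`, verbatim.) [folklore] -/
theorem curveBlowUp_run_const :
    let clean : ((Fin 2 → ℕ) → (ZMod 2)) → ((Fin 2 → ℕ) → (ZMod 2)) := fun c A => @ite (ZMod 2) (∀ j, 2 ∣ A j) (Classical.dec _) 0 (c A);
    let bl : Fin 2 → ((Fin 2 → ℕ) → (ZMod 2)) → ((Fin 2 → ℕ) → (ZMod 2)) := fun i c B => @ite (ZMod 2) (Finset.sum (Finset.univ.erase i) (fun j => B j) ≤ B i) (Classical.dec _) (c (Function.update B i (B i - Finset.sum (Finset.univ.erase i) (fun j => B j)))) 0;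
    let ord : ((Fin 2 → ℕ) → (ZMod 2)) → ℕ := fun c => sInf {m : ℕ | ∃ A, c A ≠ 0 ∧ m = Finset.sum Finset.univ (fun j => A j)};
    let dv : Fin 2 → ℕ → ((Fin 2 → ℕ) → (ZMod 2)) → ((Fin 2 → ℕ) → (ZMod 2)) := fun i s c B => c (Function.update B i (B i + s));
    let tr : Fin 2 → (Fin 2 → (ZMod 2)) → ℕ → ((Fin 2 → ℕ) → (ZMod 2)) → ((Fin 2 → ℕ) → (ZMod 2)) := fun i τ s c B => Finset.sum (Fintype.piFinset (fun _ : Fin 2 => Finset.range (B i + s + 1))) (fun D => @ite (ZMod 2) (D i = 0) (Classical.dec _) (c (B + D) * Finset.prod (Finset.univ.erase i) (fun j => ((Nat.choose (B j + D j) (B j) : ℕ) : (ZMod 2)) * τ j ^ (D j))) 0);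
    let step : Fin 2 → (Fin 2 → (ZMod 2)) → ((Fin 2 → ℕ) → (ZMod 2)) → ((Fin 2 → ℕ) → (ZMod 2)) := fun i τ c => clean (tr i τ (@ite ℕ (2 ≤ ord (clean c)) (Classical.dec _) 2 0) (dv i (@ite ℕ (2 ≤ ord (clean c)) (Classical.dec _) 2 0) (bl i (clean c))));
    let run : ((Fin 2 → ℕ) → (ZMod 2)) → (ℕ → Fin 2) → (ℕ → Fin 2 → (ZMod 2)) → ℕ → ((Fin 2 → ℕ) → (ZMod 2)) := fun c₀ i t m => @Nat.rec (fun _ => (Fin 2 → ℕ) → (ZMod 2)) c₀ (fun m c => step (i m) (t m) c) m;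
    ∀ m, run (fun A : Fin 2 → ℕ => if A 0 = 1 ∧ A 1 = 2 then (1 : ZMod 2) else 0) (fun _ : ℕ => (0 : Fin 2)) (fun (_ : ℕ) (_ : Fin 2) => (0 : ZMod 2)) m = (fun A : Fin 2 → ℕ => if A 0 = 1 ∧ A 1 = 2 then (1 : ZMod 2) else 0) := by
  intro clean bl ord dv tr step run
  set cst : (Fin 2 → ℕ) → ZMod 2 := (fun A : Fin 2 → ℕ => if A 0 = 1 ∧ A 1 = 2 then (1 : ZMod 2) else 0) with hcst
  have hne : ∀ A : Fin 2 → ℕ, cst A ≠ 0 ↔ A 0 = 1 ∧ A 1 = 2 := fun A => by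
    rw [hcst]; dsimp only; split_ifs with h <;> simp [h]
  have hcl : clean cst = cst := by
    funext A
    show @ite (ZMod 2) (∀ j, 2 ∣ A j) (Classical.dec _) 0 (cst A) = cst A
    split_ifs with h
    · symm
      by_contra hA
      have h0 := ((hne A).1 hA).1
      have := h 0
      omega
    · rfl
  have hord : ord cst = 3 := by
    show sInf {m : ℕ | ∃ A, cst A ≠ 0 ∧ m = Finset.sum Finset.univ (fun j => A j)} = 3
    have : {m : ℕ | ∃ A, cst A ≠ 0 ∧ m = Finset.sum Finset.univ (fun j => A j)} = {3} := by
      ext m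
      simp only [Set.mem_setOf_eq, Set.mem_singleton_iff, hne, Fin.sum_univ_two]
      constructor
      · rintro ⟨A, ⟨h0, h1⟩, rfl⟩; omega
      · intro hm; exact ⟨![1, 2], by simp, by simp [hm]⟩
    rw [this, csInf_singleton]
  have he : (Finset.univ : Finset (Fin 2)).erase 0 = {1} := by decide
  have hdb : dv 0 2 (bl 0 cst) = cst := by
    funext B
    show @ite (ZMod 2) (Finset.sum (Finset.univ.erase 0) (fun j => (Function.update B 0 (B 0 + 2)) j) ≤
        (Function.update B 0 (B 0 + 2)) 0) (Classical.dec _)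
        (cst (Function.update (Function.update B 0 (B 0 + 2)) 0 ((Function.update B 0 (B 0 + 2)) 0 -
          Finset.sum (Finset.univ.erase 0) (fun j => (Function.update B 0 (B 0 + 2)) j)))) 0 = cst B
    simp only [he, Finset.sum_singleton, Function.update_self, ne_eq, one_ne_zero, not_false_eq_true,
      Function.update_of_ne, Function.update_idem]
    rw [hcst]
    simp only [Function.update_self, ne_eq, one_ne_zero, not_false_eq_true, Function.update_of_ne]
    by_cases h1 : B 1 = 2
    · simp [h1]
    · simp [h1]
  have htr : ∀ Y : (Fin 2 → ℕ) → ZMod 2, tr 0 (fun _ => 0) 2 Y = Y := fun Y =>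
    funext fun B => taylorShift_zero 2 (ZMod 2) 0 2 Y B
  have hstep : step 0 (fun _ => 0) cst = cst := by
    show clean (tr 0 (fun _ => 0) (@ite ℕ (2 ≤ ord (clean cst)) (Classical.dec _) 2 0)
      (dv 0 (@ite ℕ (2 ≤ ord (clean cst)) (Classical.dec _) 2 0) (bl 0 (clean cst)))) = cst
    rw [hcl, hord, if_pos (by norm_num), htr, hdb, hcl]
  intro m
  induction m with
  | zero => rfl
  | succ m ih =>
    show step 0 (fun _ => 0) (run cst (fun _ : ℕ => (0 : Fin 2)) (fun (_ : ℕ) (_ : Fin 2) => (0 : ZMod 2)) m) = cst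
    rw [ih]
    exact hstep

/-- `a = u₀u₁²` has multiplicity `2`: cleaned, non-zero, of order `3 ≥ 2`. [folklore] -/
theorem curveBlowUp_multP :
    let clean : ((Fin 2 → ℕ) → (ZMod 2)) → ((Fin 2 → ℕ) → (ZMod 2)) := fun c A => @ite (ZMod 2) (∀ j, 2 ∣ A j) (Classical.dec _) 0 (c A);
    let MultP : ((Fin 2 → ℕ) → (ZMod 2)) → Prop := fun c => (∃ A, clean c A ≠ 0) ∧ ∀ A, clean c A ≠ 0 → 2 ≤ Finset.sum Finset.univ (fun j => A j);
    MultP (fun A : Fin 2 → ℕ => if A 0 = 1 ∧ A 1 = 2 then (1 : ZMod 2) else 0) := by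
  intro clean MultP
  set cst : (Fin 2 → ℕ) → ZMod 2 := (fun A : Fin 2 → ℕ => if A 0 = 1 ∧ A 1 = 2 then (1 : ZMod 2) else 0) with hcst
  have hne : ∀ A : Fin 2 → ℕ, cst A ≠ 0 ↔ A 0 = 1 ∧ A 1 = 2 := fun A => by
    rw [hcst]; dsimp only; split_ifs with h <;> simp [h]
  have hcl : ∀ A, clean cst A = cst A := by
    intro A
    show @ite (ZMod 2) (∀ j, 2 ∣ A j) (Classical.dec _) 0 (cst A) = cst A
    split_ifs with h
    · symm
      by_contra hA
      have h0 := ((hne A).1 hA).1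
      have := h 0
      omega
    · rfl
  show (∃ A, clean cst A ≠ 0) ∧ ∀ A, clean cst A ≠ 0 → 2 ≤ Finset.sum Finset.univ (fun j => A j)
  simp only [hcl]
  refine ⟨⟨![1, 2], (hne _).2 ⟨rfl, rfl⟩⟩, fun A hA => ?_⟩
  rw [hne] at hA
  simp [Fin.sum_univ_two, hA.1, hA.2]

/-- Every state of the constant run has multiplicity `2`. [folklore] -/
theorem curveBlowUp_run_multP :
    let clean : ((Fin 2 → ℕ) → (ZMod 2)) → ((Fin 2 → ℕ) → (ZMod 2)) := fun c A => @ite (ZMod 2) (∀ j, 2 ∣ A j) (Classical.dec _) 0 (c A);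
    let bl : Fin 2 → ((Fin 2 → ℕ) → (ZMod 2)) → ((Fin 2 → ℕ) → (ZMod 2)) := fun i c B => @ite (ZMod 2) (Finset.sum (Finset.univ.erase i) (fun j => B j) ≤ B i) (Classical.dec _) (c (Function.update B i (B i - Finset.sum (Finset.univ.erase i) (fun j => B j)))) 0;
    let ord : ((Fin 2 → ℕ) → (ZMod 2)) → ℕ := fun c => sInf {m : ℕ | ∃ A, c A ≠ 0 ∧ m = Finset.sum Finset.univ (fun j => A j)};
    let dv : Fin 2 → ℕ → ((Fin 2 → ℕ) → (ZMod 2)) → ((Fin 2 → ℕ) → (ZMod 2)) := fun i s c B => c (Function.update B i (B i + s));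
    let tr : Fin 2 → (Fin 2 → (ZMod 2)) → ℕ → ((Fin 2 → ℕ) → (ZMod 2)) → ((Fin 2 → ℕ) → (ZMod 2)) := fun i τ s c B => Finset.sum (Fintype.piFinset (fun _ : Fin 2 => Finset.range (B i + s + 1))) (fun D => @ite (ZMod 2) (D i = 0) (Classical.dec _) (c (B + D) * Finset.prod (Finset.univ.erase i) (fun j => ((Nat.choose (B j + D j) (B j) : ℕ) : (ZMod 2)) * τ j ^ (D j))) 0);
    let step : Fin 2 → (Fin 2 → (ZMod 2)) → ((Fin 2 → ℕ) → (ZMod 2)) → ((Fin 2 → ℕ) → (ZMod 2)) := fun i τ c => clean (tr i τ (@ite ℕ (2 ≤ ord (clean c)) (Classical.dec _) 2 0) (dv i (@ite ℕ (2 ≤ ord (clean c)) (Classical.dec _) 2 0) (bl i (clean c))));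
    let run : ((Fin 2 → ℕ) → (ZMod 2)) → (ℕ → Fin 2) → (ℕ → Fin 2 → (ZMod 2)) → ℕ → ((Fin 2 → ℕ) → (ZMod 2)) := fun c₀ i t m => @Nat.rec (fun _ => (Fin 2 → ℕ) → (ZMod 2)) c₀ (fun m c => step (i m) (t m) c) m;
    let MultP : ((Fin 2 → ℕ) → (ZMod 2)) → Prop := fun c => (∃ A, clean c A ≠ 0) ∧ ∀ A, clean c A ≠ 0 → 2 ≤ Finset.sum Finset.univ (fun j => A j);
    ∀ m, MultP (run (fun A : Fin 2 → ℕ => if A 0 = 1 ∧ A 1 = 2 then (1 : ZMod 2) else 0) (fun _ : ℕ => (0 : Fin 2)) (fun (_ : ℕ) (_ : Fin 2) => (0 : ZMod 2)) m) := by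
  intro clean bl ord dv tr step run MultP m
  have hr : run (fun A : Fin 2 → ℕ => if A 0 = 1 ∧ A 1 = 2 then (1 : ZMod 2) else 0) (fun _ : ℕ => (0 : Fin 2)) (fun (_ : ℕ) (_ : Fin 2) => (0 : ZMod 2)) m = (fun A : Fin 2 → ℕ => if A 0 = 1 ∧ A 1 = 2 then (1 : ZMod 2) else 0) :=
    curveBlowUp_run_const m
  rw [hr]
  exact curveBlowUp_multP

/-- The constant run returns to a pair-isomorphic state after ONE step — indeed to the same state:
`PairIso (run 0) (run 1)` with `φ = id`, `v = 1`, `g = 0`. [folklore] -/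
theorem curveBlowUp_pairIso :
    let clean : ((Fin 2 → ℕ) → (ZMod 2)) → ((Fin 2 → ℕ) → (ZMod 2)) := fun c A => @ite (ZMod 2) (∀ j, 2 ∣ A j) (Classical.dec _) 0 (c A);
    let bl : Fin 2 → ((Fin 2 → ℕ) → (ZMod 2)) → ((Fin 2 → ℕ) → (ZMod 2)) := fun i c B => @ite (ZMod 2) (Finset.sum (Finset.univ.erase i) (fun j => B j) ≤ B i) (Classical.dec _) (c (Function.update B i (B i - Finset.sum (Finset.univ.erase i) (fun j => B j)))) 0;
    let ord : ((Fin 2 → ℕ) → (ZMod 2)) → ℕ := fun c => sInf {m : ℕ | ∃ A, c A ≠ 0 ∧ m = Finset.sum Finset.univ (fun j => A j)};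
    let dv : Fin 2 → ℕ → ((Fin 2 → ℕ) → (ZMod 2)) → ((Fin 2 → ℕ) → (ZMod 2)) := fun i s c B => c (Function.update B i (B i + s));
    let tr : Fin 2 → (Fin 2 → (ZMod 2)) → ℕ → ((Fin 2 → ℕ) → (ZMod 2)) → ((Fin 2 → ℕ) → (ZMod 2)) := fun i τ s c B => Finset.sum (Fintype.piFinset (fun _ : Fin 2 => Finset.range (B i + s + 1))) (fun D => @ite (ZMod 2) (D i = 0) (Classical.dec _) (c (B + D) * Finset.prod (Finset.univ.erase i) (fun j => ((Nat.choose (B j + D j) (B j) : ℕ) : (ZMod 2)) * τ j ^ (D j))) 0);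
    let step : Fin 2 → (Fin 2 → (ZMod 2)) → ((Fin 2 → ℕ) → (ZMod 2)) → ((Fin 2 → ℕ) → (ZMod 2)) := fun i τ c => clean (tr i τ (@ite ℕ (2 ≤ ord (clean c)) (Classical.dec _) 2 0) (dv i (@ite ℕ (2 ≤ ord (clean c)) (Classical.dec _) 2 0) (bl i (clean c))));
    let run : ((Fin 2 → ℕ) → (ZMod 2)) → (ℕ → Fin 2) → (ℕ → Fin 2 → (ZMod 2)) → ℕ → ((Fin 2 → ℕ) → (ZMod 2)) := fun c₀ i t m => @Nat.rec (fun _ => (Fin 2 → ℕ) → (ZMod 2)) c₀ (fun m c => step (i m) (t m) c) m;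
    let ser : ((Fin 2 → ℕ) → (ZMod 2)) → MvPowerSeries (Fin 2) (ZMod 2) := fun c => show MvPowerSeries (Fin 2) (ZMod 2) from fun A : Fin 2 →₀ ℕ => clean c ⇑A;
    let PairIso : ((Fin 2 → ℕ) → (ZMod 2)) → ((Fin 2 → ℕ) → (ZMod 2)) → Prop := fun c c' => ∃ (φ : MvPowerSeries (Fin 2) (ZMod 2) ≃ₐ[(ZMod 2)] MvPowerSeries (Fin 2) (ZMod 2)) (v g : MvPowerSeries (Fin 2) (ZMod 2)), IsUnit v ∧ φ (ser c) = v ^ 2 * ser c' + g ^ 2;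
    PairIso (run (fun A : Fin 2 → ℕ => if A 0 = 1 ∧ A 1 = 2 then (1 : ZMod 2) else 0) (fun _ : ℕ => (0 : Fin 2)) (fun (_ : ℕ) (_ : Fin 2) => (0 : ZMod 2)) 0) (run (fun A : Fin 2 → ℕ => if A 0 = 1 ∧ A 1 = 2 then (1 : ZMod 2) else 0) (fun _ : ℕ => (0 : Fin 2)) (fun (_ : ℕ) (_ : Fin 2) => (0 : ZMod 2)) 1) := by
  intro clean bl ord dv tr step run ser PairIso
  have h0 : run (fun A : Fin 2 → ℕ => if A 0 = 1 ∧ A 1 = 2 then (1 : ZMod 2) else 0) (fun _ : ℕ => (0 : Fin 2)) (fun (_ : ℕ) (_ : Fin 2) => (0 : ZMod 2)) 0 = (fun A : Fin 2 → ℕ => if A 0 = 1 ∧ A 1 = 2 then (1 : ZMod 2) else 0) :=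
    curveBlowUp_run_const 0
  have h1 : run (fun A : Fin 2 → ℕ => if A 0 = 1 ∧ A 1 = 2 then (1 : ZMod 2) else 0) (fun _ : ℕ => (0 : Fin 2)) (fun (_ : ℕ) (_ : Fin 2) => (0 : ZMod 2)) 1 = (fun A : Fin 2 → ℕ => if A 0 = 1 ∧ A 1 = 2 then (1 : ZMod 2) else 0) :=
    curveBlowUp_run_const 1
  rw [h0, h1]
  exact ⟨AlgEquiv.refl, 1, 0, isUnit_one, by simp⟩

/-- **`Isol` is load-bearing in the conclusion.** `IsolatedForcedTermination` with the forcedness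
predicate `Isol` deleted (verbatim the route's `let`-telescope otherwise) is FALSE: witness `p = 2`,
`n = 2`, `κ = 𝔽₂`, `a = u₀u₁²`, chart word `0,0,…`, translations `0` — an eternal multiplicity-`2`
run (`curveBlowUp_run_multP`). [folklore] -/
theorem isolatedForcedTermination_false_without_Isol :
    ¬ (∀ p : ℕ, p.Prime → ∀ n : ℕ, 0 < n → ∀ (κ : Type) [Field κ] [CharP κ p] [PerfectField κ]
      (c₀ : (Fin n → ℕ) → κ) (i : ℕ → Fin n) (t : ℕ → Fin n → κ),
    let clean : ((Fin n → ℕ) → κ) → ((Fin n → ℕ) → κ) := fun c A => @ite κ (∀ j, p ∣ A j) (Classical.dec _) 0 (c A);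
    let bl : Fin n → ((Fin n → ℕ) → κ) → ((Fin n → ℕ) → κ) := fun i c B => @ite κ (Finset.sum (Finset.univ.erase i) (fun j => B j) ≤ B i) (Classical.dec _) (c (Function.update B i (B i - Finset.sum (Finset.univ.erase i) (fun j => B j)))) 0;
    let ord : ((Fin n → ℕ) → κ) → ℕ := fun c => sInf {m : ℕ | ∃ A, c A ≠ 0 ∧ m = Finset.sum Finset.univ (fun j => A j)};
    let dv : Fin n → ℕ → ((Fin n → ℕ) → κ) → ((Fin n → ℕ) → κ) := fun i s c B => c (Function.update B i (B i + s));
    let tr : Fin n → (Fin n → κ) → ℕ → ((Fin n → ℕ) → κ) → ((Fin n → ℕ) → κ) := fun i τ s c B => Finset.sum (Fintype.piFinset (fun _ : Fin n => Finset.range (B i + s + 1))) (fun D => @ite κ (D i = 0) (Classical.dec _) (c (B + D) * Finset.prod (Finset.univ.erase i) (fun j => ((Nat.choose (B j + D j) (B j) : ℕ) : κ) * τ j ^ (D j))) 0);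
    let step : Fin n → (Fin n → κ) → ((Fin n → ℕ) → κ) → ((Fin n → ℕ) → κ) := fun i τ c => clean (tr i τ (@ite ℕ (p ≤ ord (clean c)) (Classical.dec _) p 0) (dv i (@ite ℕ (p ≤ ord (clean c)) (Classical.dec _) p 0) (bl i (clean c))));
    let run : ((Fin n → ℕ) → κ) → (ℕ → Fin n) → (ℕ → Fin n → κ) → ℕ → ((Fin n → ℕ) → κ) := fun c₀ i t m => @Nat.rec (fun _ => (Fin n → ℕ) → κ) c₀ (fun m c => step (i m) (t m) c) m;
    let MultP : ((Fin n → ℕ) → κ) → Prop := fun c => (∃ A, clean c A ≠ 0) ∧ ∀ A, clean c A ≠ 0 → p ≤ Finset.sum Finset.univ (fun j => A j);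
    ¬ (∀ m, MultP (run c₀ i t m))) := by
  intro h
  exact h 2 Nat.prime_two 2 two_pos (ZMod 2) (fun A : Fin 2 → ℕ => if A 0 = 1 ∧ A 1 = 2 then (1 : ZMod 2) else 0) (fun _ : ℕ => (0 : Fin 2)) (fun (_ : ℕ) (_ : Fin 2) => (0 : ZMod 2))
    curveBlowUp_run_multP

/-- **`Isol` is load-bearing in the certificate, too.** `NoPeriodicIsolatedAtom` with `Isol` deleted
(verbatim otherwise) is FALSE: the same atom over the prime field `𝔽₂` (algebraic over `ZMod 2`)
returns to ITSELF after one step, so `PairIso (run 0) (run 1)` holds with `φ = id`, `v = 1`, `g = 0`.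
[folklore] -/
theorem noPeriodicIsolatedAtom_false_without_Isol :
    ¬ (∀ p : ℕ, p.Prime → ∀ n : ℕ, 0 < n → ∀ (κ : Type) [Field κ] [Algebra (ZMod p) κ]
      [Algebra.IsAlgebraic (ZMod p) κ] (c₀ : (Fin n → ℕ) → κ) (i : ℕ → Fin n) (t : ℕ → Fin n → κ)
      (r : ℕ), 0 < r →
    let clean : ((Fin n → ℕ) → κ) → ((Fin n → ℕ) → κ) := fun c A => @ite κ (∀ j, p ∣ A j) (Classical.dec _) 0 (c A);
    let bl : Fin n → ((Fin n → ℕ) → κ) → ((Fin n → ℕ) → κ) := fun i c B => @ite κ (Finset.sum (Finset.univ.erase i) (fun j => B j) ≤ B i) (Classical.dec _) (c (Function.update B i (B i - Finset.sum (Finset.univ.erase i) (fun j => B j)))) 0;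
    let ord : ((Fin n → ℕ) → κ) → ℕ := fun c => sInf {m : ℕ | ∃ A, c A ≠ 0 ∧ m = Finset.sum Finset.univ (fun j => A j)};
    let dv : Fin n → ℕ → ((Fin n → ℕ) → κ) → ((Fin n → ℕ) → κ) := fun i s c B => c (Function.update B i (B i + s));
    let tr : Fin n → (Fin n → κ) → ℕ → ((Fin n → ℕ) → κ) → ((Fin n → ℕ) → κ) := fun i τ s c B => Finset.sum (Fintype.piFinset (fun _ : Fin n => Finset.range (B i + s + 1))) (fun D => @ite κ (D i = 0) (Classical.dec _) (c (B + D) * Finset.prod (Finset.univ.erase i) (fun j => ((Nat.choose (B j + D j) (B j) : ℕ) : κ) * τ j ^ (D j))) 0);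
    let step : Fin n → (Fin n → κ) → ((Fin n → ℕ) → κ) → ((Fin n → ℕ) → κ) := fun i τ c => clean (tr i τ (@ite ℕ (p ≤ ord (clean c)) (Classical.dec _) p 0) (dv i (@ite ℕ (p ≤ ord (clean c)) (Classical.dec _) p 0) (bl i (clean c))));
    let run : ((Fin n → ℕ) → κ) → (ℕ → Fin n) → (ℕ → Fin n → κ) → ℕ → ((Fin n → ℕ) → κ) := fun c₀ i t m => @Nat.rec (fun _ => (Fin n → ℕ) → κ) c₀ (fun m c => step (i m) (t m) c) m;
    let ser : ((Fin n → ℕ) → κ) → MvPowerSeries (Fin n) κ := fun c => show MvPowerSeries (Fin n) κ from fun A : Fin n →₀ ℕ => clean c ⇑A;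
    let MultP : ((Fin n → ℕ) → κ) → Prop := fun c => (∃ A, clean c A ≠ 0) ∧ ∀ A, clean c A ≠ 0 → p ≤ Finset.sum Finset.univ (fun j => A j);
    let PairIso : ((Fin n → ℕ) → κ) → ((Fin n → ℕ) → κ) → Prop := fun c c' => ∃ (φ : MvPowerSeries (Fin n) κ ≃ₐ[κ] MvPowerSeries (Fin n) κ) (v g : MvPowerSeries (Fin n) κ), IsUnit v ∧ φ (ser c) = v ^ p * ser c' + g ^ p;
    (∀ m, m ≤ r → MultP (run c₀ i t m)) → ¬ PairIso (run c₀ i t 0) (run c₀ i t r)) := by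
  intro h
  exact h 2 Nat.prime_two 2 two_pos (ZMod 2) (fun A : Fin 2 → ℕ => if A 0 = 1 ∧ A 1 = 2 then (1 : ZMod 2) else 0) (fun _ : ℕ => (0 : Fin 2)) (fun (_ : ℕ) (_ : Fin 2) => (0 : ZMod 2)) 1 one_pos
    (fun m _ => curveBlowUp_run_multP m) curveBlowUp_pairIso

/-- **The witness is NOT isolated** (so the two lemmas above refute the weakenings, not the target):
in the Milnor algebra `𝔽₂[[u₀,u₁]]/(∂a/∂u₀, ∂a/∂u₁) = 𝔽₂[[u₀,u₁]]/(u₁², 0)` the powers `u₀ᵏ` are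
linearly independent (an element of `(u₁²)` has no pure-`u₀` monomial), hence the algebra is not
finite over `𝔽₂`. [folklore] -/
theorem curveBlowUp_witness_not_isolated :
    let clean : ((Fin 2 → ℕ) → (ZMod 2)) → ((Fin 2 → ℕ) → (ZMod 2)) := fun c A => @ite (ZMod 2) (∀ j, 2 ∣ A j) (Classical.dec _) 0 (c A);
    let ser : ((Fin 2 → ℕ) → (ZMod 2)) → MvPowerSeries (Fin 2) (ZMod 2) := fun c => show MvPowerSeries (Fin 2) (ZMod 2) from fun A : Fin 2 →₀ ℕ => clean c ⇑A;
    let pd : Fin 2 → MvPowerSeries (Fin 2) (ZMod 2) → MvPowerSeries (Fin 2) (ZMod 2) := fun i f => show MvPowerSeries (Fin 2) (ZMod 2) from fun A : Fin 2 →₀ ℕ => ((A i + 1 : ℕ) : (ZMod 2)) * f (A + Finsupp.single i 1);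
    let jac : ((Fin 2 → ℕ) → (ZMod 2)) → Ideal (MvPowerSeries (Fin 2) (ZMod 2)) := fun c => Ideal.span (Set.range (fun i => pd i (ser c)));
    let Isol : ((Fin 2 → ℕ) → (ZMod 2)) → Prop := fun c => Module.Finite (ZMod 2) (MvPowerSeries (Fin 2) (ZMod 2) ⧸ jac c);
    ¬ Isol (fun A : Fin 2 → ℕ => if A 0 = 1 ∧ A 1 = 2 then (1 : ZMod 2) else 0) := by
  intro clean ser pd jac Isol
  set cst : (Fin 2 → ℕ) → ZMod 2 := (fun A : Fin 2 → ℕ => if A 0 = 1 ∧ A 1 = 2 then (1 : ZMod 2) else 0) with hcst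
  have hne : ∀ A : Fin 2 → ℕ, cst A ≠ 0 ↔ A 0 = 1 ∧ A 1 = 2 := fun A => by
    rw [hcst]; dsimp only; split_ifs with h <;> simp [h]
  have hcl : ∀ A, clean cst A = cst A := by
    intro A
    show @ite (ZMod 2) (∀ j, 2 ∣ A j) (Classical.dec _) 0 (cst A) = cst A
    split_ifs with h
    · symm
      by_contra hA
      have h0 := ((hne A).1 hA).1
      have := h 0
      omega
    · rfl
  have hpd0 : pd 0 (ser cst) = MvPowerSeries.X 1 ^ 2 := by
    ext A
    show ((A 0 + 1 : ℕ) : ZMod 2) * clean cst ⇑(A + Finsupp.single (0 : Fin 2) (1 : ℕ)) =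
      MvPowerSeries.coeff A (MvPowerSeries.X 1 ^ 2)
    rw [hcl, MvPowerSeries.coeff_X_pow, hcst]
    simp only [Finsupp.coe_add, Pi.add_apply, Finsupp.single_eq_same, ne_eq, one_ne_zero,
      not_false_eq_true, Finsupp.single_eq_of_ne, add_zero, Nat.add_eq_right]
    by_cases hA : A = Finsupp.single (1 : Fin 2) (2 : ℕ)
    · subst hA; simp
    · rw [if_neg hA, if_neg, mul_zero]
      rintro ⟨h0, h1⟩
      apply hA
      ext j
      fin_cases j
      · simpa using h0
      · simpa using h1
  have hpd1 : pd 1 (ser cst) = 0 := by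
    ext A
    show ((A 1 + 1 : ℕ) : ZMod 2) * clean cst ⇑(A + Finsupp.single (1 : Fin 2) (1 : ℕ)) =
      MvPowerSeries.coeff A 0
    rw [hcl, map_zero, hcst]
    simp only [Finsupp.coe_add, Pi.add_apply, Finsupp.single_eq_same, ne_eq, zero_ne_one,
      not_false_eq_true, Finsupp.single_eq_of_ne, add_zero]
    split_ifs with h
    · obtain ⟨-, h1⟩ := h
      have : A 1 = 1 := by omega
      rw [this]
      decide
    · rw [mul_zero]
  have hjac : jac cst ≤ Ideal.span {MvPowerSeries.X 1 ^ 2} := by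
    show Ideal.span (Set.range (fun i => pd i (ser cst))) ≤ _
    rw [Ideal.span_le]
    rintro f ⟨i, rfl⟩
    fin_cases i
    · exact Ideal.subset_span (by simp [hpd0])
    · simp [hpd1]
  intro hfin
  change Module.Finite (ZMod 2) (MvPowerSeries (Fin 2) (ZMod 2) ⧸ jac cst) at hfin
  have hli : LinearIndependent (ZMod 2)
      (fun k : ℕ => Ideal.Quotient.mk (jac cst) (MvPowerSeries.X 0 ^ k)) := by
    rw [linearIndependent_iff']
    intro s a hs k hk
    have hsum : Ideal.Quotient.mk (jac cst) (s.sum fun j => a j • MvPowerSeries.X (0 : Fin 2) ^ j) = 0 := by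
      rw [map_sum, ← hs]
      exact Finset.sum_congr rfl fun _ _ => rfl
    rw [Ideal.Quotient.eq_zero_iff_mem] at hsum
    have hdvd : MvPowerSeries.X (1 : Fin 2) ^ 2 ∣
        s.sum fun j => a j • MvPowerSeries.X (0 : Fin 2) ^ j :=
      Ideal.mem_span_singleton.1 (hjac hsum)
    rw [MvPowerSeries.X_pow_dvd_iff] at hdvd
    have hk0 := hdvd (Finsupp.single 0 k) (by simp)
    rw [map_sum, Finset.sum_eq_single k] at hk0
    · simpa [MvPowerSeries.coeff_X_pow] using hk0
    · intro j _ hjk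
      rw [map_smul, MvPowerSeries.coeff_X_pow, if_neg, smul_zero]
      intro h
      apply hjk
      have := congrArg (fun f => f 0) h
      simpa using this.symm
    · intro hks; exact (hks hk).elim
  have : Finite ℕ := hli.finite_of_isNoetherian
  exact not_finite ℕ

end Summit.ResolutionOfSingularities.ResolutionOfSingularities.Theorems.ClosingReduction.Negative

end
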